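import Mathlib
import Summits.ValiantsHypothesis.ValiantsHypothesis.Theorems.DivisionGapZeroOneTransferStubBlockRestriction
import Summits.ValiantsHypothesis.ValiantsHypothesis.Theorems.DivisionGapZeroOneTransferStubBlockComplementCover
import Summits.ValiantsHypothesis.ValiantsHypothesis.Theorems.TriangularDimersDivisionEasy.Negative.UnitH
import Summits.ValiantsHypothesis.ValiantsHypothesis.Theorems.PerDivisionHard.Negative.VarsCounting
import Literature.Computability.AlgebraicComplexity.ValiantClassesProofs

/-!
# Crux `DivisionGap.ZeroOneTransfer` (stmt-ValiantsHypothesis-5066), line `charged-uncharged`, Part D-I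
(lead c12): OMNIPRESENCE of uncharged certificates at the decisive instance `D_n`

The uncharged child `MonotoneMultiples` of the crux, restricted to Valiant's rhombus dimer family
`D_n = triPM n` (crux 4), asks for SOME nonzero `X ≥ 0` with `L₊(D_n · X)` quasi-polynomial.  This file
assembles the registered Part-D stubs `stub_blockRestriction` (p156315) and `stub_blockComplementCover`
(p156500) with Valiant's bound for unit-constant cofactors (`monotone_lower_bound_of_coeff_zero_ne_zero`,
crux-4 toolkit `UnitH`) into a necessary condition on any such `X`:

* `valiant_of_avoids_block` — if ONE monomial of `X` uses no variable `x_(a,b)` with `a` in the aligned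
  block `[p m, p m + m) × [q m, q m + m)` (`m` even, `≥ 64`), then Valiant's bound for `D_m` holds with
  `L₊(D_n · X)` in place of `L₊(D_m)`: `T^L ≤ 4 · L₊(D_n · X) · (m²+1)² · (T-1)^L` (`24L + 60 ≤ m`).  The
  block substitution (`1` outside, `0` on the edges leaving the block, block-local variables inside) is a
  positive projection, hence free, and lands on `c · D_m · X'` with `X'(0) ≠ 0`.
* `exists_block_avoiding` — pigeonhole: a vertex set with fewer than `(n/m)²` elements misses one of the
  `(n/m)²` disjoint aligned `m`-blocks.
* `mm_certificate_blockFloor` — hence the same bound whenever some monomial of `X` meets fewer than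
  `(n/m)²` first vertices: every monomial of a cheap certificate meets EVERY aligned block.
* `not_mm_certificate_of_degree_le` — asymptotic corollary: no family of cofactors `X_n ≠ 0` of total
  degree `≤ n` (`= √(deg D_n)`) makes `L₊(D_n · X_n)` quasi-polynomial (lead c11 asked for degree `≤ n/64`);
* `not_mm_certificate_with_sparse_monomial` — nor any family having a monomial with fewer than
  `n² / 2^((log₂ n + c)^c)` variables: an MM certificate for `D_n` is as large as `D_n` itself up to
  quasi-polynomial factors and omnipresent at every quasi-polynomial scale.
* `not_triDivisionEasy_of_degree_le`, `not_triDivisionEasy_with_sparse_monomial` — the same two rungs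
  for the CHARGED crux 4 (`TriangularDimersDivisionEasy`): successful denominators have degree `> n` and
  are omnipresent (appended, lead c12).
[cite: Valiant1980, §3 Thm 1]
-/

noncomputable section

-- `Summit.ValiantsHypothesis.ValiantsHypothesis.…` is the tree's mandated single-conjunct layout
-- (Sub = Summit), so the duplicated namespace component is intended.
set_option linter.dupNamespace false

namespace Summit.ValiantsHypothesis.ValiantsHypothesis.Theorems.DivisionGapZeroOneTransfer

open MvPolynomial
open Literature.Computability.AlgebraicComplexity
open Summit.ValiantsHypothesis.ValiantsHypothesis.Theorems.TriangularDimersDivisionEasy.Negative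
open scoped NNReal BigOperators

namespace MmBlockFloor

variable {n : ℕ}

/-! ### Pigeonhole: a small vertex set misses an aligned block -/

/-- A vertex in the aligned block `(p, q)` of side `m` has block coordinates `(p, q)`. [folklore] -/
theorem div_eq_of_mem_block {m p q i j : ℕ}
    (hi : p * m ≤ i ∧ i < p * m + m) (hj : q * m ≤ j ∧ j < q * m + m) :
    i / m = p ∧ j / m = q := by
  constructor
  · exact Nat.div_eq_of_lt_le hi.1 (by rw [Nat.succ_mul]; exact hi.2)
  · exact Nat.div_eq_of_lt_le hj.1 (by rw [Nat.succ_mul]; exact hj.2)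

/-- **Pigeonhole.**  A set of fewer than `(n/m)²` vertices misses one of the `(n/m)²` pairwise disjoint
aligned `m`-blocks `[p m, p m + m) × [q m, q m + m)`, `p, q < n/m`. [folklore] -/
theorem exists_block_avoiding {m : ℕ} (S : Finset (Fin n × Fin n))
    (hS : S.card < (n / m) * (n / m)) :
    ∃ p q : ℕ, p < n / m ∧ q < n / m ∧ ∀ v ∈ S,
      ¬ ((p * m ≤ (v.1 : ℕ) ∧ (v.1 : ℕ) < p * m + m) ∧ (q * m ≤ (v.2 : ℕ) ∧ (v.2 : ℕ) < q * m + m)) := by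
  classical
  by_contra hcon
  push Not at hcon
  -- every block index pair is the block coordinate of some element of `S`
  set φ : Fin n × Fin n → ℕ × ℕ := fun v => ((v.1 : ℕ) / m, (v.2 : ℕ) / m) with hφ
  have hsub : Finset.range (n / m) ×ˢ Finset.range (n / m) ⊆ S.image φ := by
    intro pq hpq
    rw [Finset.mem_product, Finset.mem_range, Finset.mem_range] at hpq
    obtain ⟨v, hv, hin⟩ := hcon pq.1 pq.2 hpq.1 hpq.2
    rw [Finset.mem_image]
    refine ⟨v, hv, ?_⟩
    obtain ⟨h1, h2⟩ := div_eq_of_mem_block hin.1 hin.2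
    exact Prod.ext h1 h2
  have hcard := Finset.card_le_card hsub
  rw [Finset.card_product, Finset.card_range] at hcard
  exact absurd (hcard.trans Finset.card_image_le) (not_le.2 hS)

/-! ### The block substitution applied to a product `D_n · X` -/

/-- **Valiant's bound survives any cofactor with a monomial avoiding an aligned even block.**  For even
`n`, even `m ≥ 64`, an aligned block `[p m, p m + m) × [q m, q m + m)` inside the rhombus, `24 L + 60 ≤ m`,
and `X` with a monomial none of whose variables `x_(a,b)` has `a` in the block:
`T^L ≤ 4 · L₊(D_n · X) · (m²+1)² · (T-1)^L`.  The block substitution of `stub_blockRestriction`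
(block-local variable inside, `0` on edges leaving the block, `1` for first vertices outside) is a positive
projection, hence free (`complexity_le_of_isProjection`); it maps `D_n` to `c • D_m` (`c ≠ 0`, the
complement being coverable by `stub_blockComplementCover`) and `X` to a polynomial whose constant term
dominates the coefficient of the avoiding monomial (no cancellation over `ℝ≥0`), so Valiant's bound for
unit-constant cofactors of `D_m` applies. [cite: Valiant1980, §3 Thm 1] -/
theorem valiant_of_avoids_block {m p q : ℕ} (hn : Even n) (h64 : 64 ≤ m) (hme : Even m)
    (hpm : p * m + m ≤ n) (hqm : q * m + m ≤ n)
    (X : MvPolynomial ((Fin n × Fin n) × (Fin n × Fin n)) ℝ≥0)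
    (hX : ∃ μ ∈ X.support, ∀ e ∈ μ.support,
      ¬ ((p * m ≤ (e.1.1 : ℕ) ∧ (e.1.1 : ℕ) < p * m + m) ∧ (q * m ≤ (e.1.2 : ℕ) ∧ (e.1.2 : ℕ) < q * m + m)))
    {L : ℕ} (hL : 24 * L + 60 ≤ m) :
    Tfib ^ L ≤ 4 * complexity (triPM n * X) * (m * m + 1) ^ 2 * (Tfib - 1) ^ L := by
  classical
  have hm : 0 < m := by omega
  obtain ⟨μ, hμ, havoid⟩ := hX
  -- the block substitution
  set φ : (Fin n × Fin n) × (Fin n × Fin n) → MvPolynomial ((Fin m × Fin m) × (Fin m × Fin m)) ℝ≥0 :=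
    fun e => if (p * m ≤ (e.1.1 : ℕ) ∧ (e.1.1 : ℕ) < p * m + m) ∧ (q * m ≤ (e.1.2 : ℕ) ∧ (e.1.2 : ℕ) < q * m + m) then
        (if (p * m ≤ (e.2.1 : ℕ) ∧ (e.2.1 : ℕ) < p * m + m) ∧ (q * m ≤ (e.2.2 : ℕ) ∧ (e.2.2 : ℕ) < q * m + m) then
          (MvPolynomial.X ((⟨((e.1.1 : ℕ) - p * m) % m, Nat.mod_lt _ hm⟩, ⟨((e.1.2 : ℕ) - q * m) % m, Nat.mod_lt _ hm⟩),
              (⟨((e.2.1 : ℕ) - p * m) % m, Nat.mod_lt _ hm⟩, ⟨((e.2.2 : ℕ) - q * m) % m, Nat.mod_lt _ hm⟩)) :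
            MvPolynomial ((Fin m × Fin m) × (Fin m × Fin m)) ℝ≥0)
        else 0)
      else 1 with hφ
  -- it is a positive projection
  have hprojφ : ∀ e, (∃ j, φ e = MvPolynomial.X j) ∨ ∃ c : ℝ≥0, φ e = C c := by
    intro e
    simp only [hφ]
    split_ifs
    · exact Or.inl ⟨_, rfl⟩
    · exact Or.inr ⟨0, by simp⟩
    · exact Or.inr ⟨1, by simp⟩
  -- outside the block (first vertex) it is `1`
  have hφ1 : ∀ e : (Fin n × Fin n) × (Fin n × Fin n),
      ¬ ((p * m ≤ (e.1.1 : ℕ) ∧ (e.1.1 : ℕ) < p * m + m) ∧ (q * m ≤ (e.1.2 : ℕ) ∧ (e.1.2 : ℕ) < q * m + m)) →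
      φ e = 1 := by
    intro e he
    simp only [hφ]
    rw [if_neg he]
  -- the complement of the block has a dimer cover, so the block restriction lands on `c • D_m`, `c ≠ 0`
  obtain ⟨g, hg⟩ := stub_blockComplementCover n m p q hn hme hpm hqm
  obtain ⟨c, hc, heq⟩ := stub_blockRestriction n m p q hm hpm hqm ⟨g, hg⟩
  have heq' : aeval φ (triPM n) = c • triPM m := heq
  -- the substituted cofactor has non-zero constant term
  set Y := aeval φ X with hY
  have hYsum : Y = ∑ ν ∈ X.support, C (coeff ν X) * ν.prod fun i k => φ i ^ k := by
    rw [hY]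
    conv_lhs => rw [X.as_sum]
    rw [map_sum]
    refine Finset.sum_congr rfl fun ν _ => ?_
    rw [aeval_monomial]
    rfl
  have hμterm : (C (coeff μ X) * μ.prod fun i k => φ i ^ k) = C (coeff μ X) := by
    rw [Finsupp.prod, Finset.prod_eq_one, mul_one]
    intro e he
    rw [hφ1 e (havoid e he), one_pow]
  have hle : coeff μ X ≤ coeff 0 Y := by
    rw [hYsum, coeff_sum]
    have := Finset.single_le_sum (s := X.support)
      (f := fun ν => coeff 0 (C (coeff ν X) * ν.prod fun i k => φ i ^ k))
      (fun _ _ => _root_.zero_le) hμ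
    simp only [hμterm, coeff_C, if_true] at this
    exact this
  have hY0' : coeff 0 Y ≠ 0 := by
    intro h0
    rw [h0, nonpos_iff_eq_zero] at hle
    exact (mem_support_iff.1 hμ) hle
  have hY0 : coeff 0 (c • Y) ≠ 0 := by
    rw [coeff_smul, smul_eq_mul]
    exact mul_ne_zero hc hY0'
  -- the substitution is free
  have hproj : IsProjection (triPM m * (c • Y)) (triPM n * X) := by
    refine ⟨φ, hprojφ, ?_⟩
    rw [map_mul, heq', hY, smul_mul_assoc, mul_smul_comm]
  have hcx : complexity (triPM m * (c • Y)) ≤ complexity (triPM n * X) :=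
    complexity_le_of_isProjection hproj
  -- Valiant's bound for `D_m` with the unit-constant cofactor `c • Y`
  have hval := monotone_lower_bound_of_coeff_zero_ne_zero h64 hme hL hY0
  calc Tfib ^ L ≤ 4 * complexity (triPM m * (c • Y)) * (m * m + 1) ^ 2 * (Tfib - 1) ^ L := hval
    _ ≤ 4 * complexity (triPM n * X) * (m * m + 1) ^ 2 * (Tfib - 1) ^ L := by
        apply Nat.mul_le_mul_right; apply Nat.mul_le_mul_right; exact Nat.mul_le_mul_left _ hcx

end MmBlockFloor

open MmBlockFloor

/-- **OMNIPRESENCE of uncharged certificates at the decisive instance (Part D-I).**  For even `n`, even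
`m ≥ 64`, `24 L + 60 ≤ m`, and any `X ∈ ℝ≥0[x]` having a monomial that meets fewer than `(n/m)²` first
vertices: `T^L ≤ 4 · L₊(D_n · X) · (m²+1)² · (T-1)^L` (`T = 6^44`), i.e. `L₊(D_n · X)` is at least Valiant's
exponential bound for `D_m`.  Contrapositively, every monomial of a quasi-polynomial MM certificate `X`
for `D_n` meets every aligned block of polylogarithmic side. [cite: Valiant1980, §3 Thm 1] -/
theorem mm_certificate_blockFloor :
    ∀ (n m : ℕ), Even n → 64 ≤ m → Even m →
      ∀ (X : MvPolynomial ((Fin n × Fin n) × (Fin n × Fin n)) ℝ≥0),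
        (∃ μ ∈ X.support, (μ.support.image fun e => e.1).card < (n / m) * (n / m)) →
        ∀ (L : ℕ), 24 * L + 60 ≤ m →
          Tfib ^ L ≤ 4 * complexity (triPM n * X) * (m * m + 1) ^ 2 * (Tfib - 1) ^ L := by
  classical
  intro n m hn h64 hme X hX L hL
  have hm : 0 < m := by omega
  obtain ⟨μ, hμ, hcard⟩ := hX
  obtain ⟨p, q, hp, hq, havoid⟩ := exists_block_avoiding (μ.support.image fun e => e.1) hcard
  have hk : (n / m) * m ≤ n := Nat.div_mul_le_self n m
  have hpm : p * m + m ≤ n := by nlinarith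
  have hqm : q * m + m ≤ n := by nlinarith
  refine valiant_of_avoids_block hn h64 hme hpm hqm X ⟨μ, hμ, fun e he => ?_⟩ hL
  exact havoid e.1 (Finset.mem_image_of_mem _ he)

/-! ### Asymptotic corollaries in the language of `MonotoneMultiples` at `D_n` -/

namespace MmBlockFloor

/-- Exponent bookkeeping: `(2j + 1 + c)^c ≤ (j + (2c+1))^(2c+1)`. [folklore] -/
theorem pow_le_pow_aux (j c : ℕ) : (2 * j + 1 + c) ^ c ≤ (j + (2 * c + 1)) ^ (2 * c + 1) := by
  have h1 : 2 * j + 1 + c ≤ (j + c + 1) ^ 2 := by nlinarith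
  calc (2 * j + 1 + c) ^ c ≤ ((j + c + 1) ^ 2) ^ c := Nat.pow_le_pow_left h1 c
    _ = (j + c + 1) ^ (2 * c) := by rw [← pow_mul]
    _ ≤ (j + (2 * c + 1)) ^ (2 * c) := Nat.pow_le_pow_left (by omega) _
    _ ≤ (j + (2 * c + 1)) ^ (2 * c + 1) := Nat.pow_le_pow_right (by omega) (by omega)

/-- **The contradiction at `n = 2^(2j+1)`.**  For every `c` there are `j ≥ 6` and `n = 2^(2j+1)` such that
no `X` with a monomial meeting fewer than `2n = (n / 2^j)²` first vertices has
`L₊(D_n · X) ≤ 2^((log₂ n + c)^c)`. [folklore] -/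
theorem exists_level_blockFloor (c : ℕ) :
    ∃ j : ℕ, 6 ≤ j ∧ ∀ X : MvPolynomial ((Fin (2 ^ (2 * j + 1)) × Fin (2 ^ (2 * j + 1))) ×
        (Fin (2 ^ (2 * j + 1)) × Fin (2 ^ (2 * j + 1)))) ℝ≥0,
      (∃ μ ∈ X.support, (μ.support.image fun e => e.1).card < 2 ^ (j + 1) * 2 ^ (j + 1)) →
      ¬ complexity (triPM (2 ^ (2 * j + 1)) * X) ≤ bound c (2 ^ (2 * j + 1)) := by
  obtain ⟨j, hj6, hviol⟩ := exists_m_violating (2 * c + 1)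
  refine ⟨j, hj6, fun X hX hle => ?_⟩
  have hn : Even (2 ^ (2 * j + 1)) := Nat.even_pow.2 ⟨even_two, by omega⟩
  have hme : Even (2 ^ j) := Nat.even_pow.2 ⟨even_two, by omega⟩
  have h64 : 64 ≤ 2 ^ j := by
    calc 64 = 2 ^ 6 := by norm_num
      _ ≤ 2 ^ j := Nat.pow_le_pow_right (by norm_num) hj6
  have hdiv : 2 ^ (2 * j + 1) / 2 ^ j = 2 ^ (j + 1) := by
    rw [Nat.pow_div (by omega) (by norm_num)]
    congr 1
    omega
  have hX' : ∃ μ ∈ X.support, (μ.support.image fun e => e.1).card <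
      (2 ^ (2 * j + 1) / 2 ^ j) * (2 ^ (2 * j + 1) / 2 ^ j) := by
    rw [hdiv]; exact hX
  have hlb : ∀ L, 24 * L + 60 ≤ 2 ^ j →
      Tfib ^ L ≤ 4 * complexity (triPM (2 ^ (2 * j + 1)) * X) * (2 ^ j * 2 ^ j + 1) ^ 2 * (Tfib - 1) ^ L :=
    fun L hL => mm_certificate_blockFloor _ _ hn h64 hme X hX' L hL
  have hlog : Nat.log 2 (2 ^ (2 * j + 1)) = 2 * j + 1 := Nat.log_pow (by norm_num) _
  have hF : complexity (triPM (2 ^ (2 * j + 1)) * X) ≤ 2 ^ ((j + (2 * c + 1)) ^ (2 * c + 1)) := by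
    refine hle.trans ?_
    unfold bound
    rw [hlog]
    exact Nat.pow_le_pow_right (by norm_num) (pow_le_pow_aux j c)
  have hkey := key_ineq_of_bound hj6 hlb hF
  exact absurd (hkey.trans_lt hviol) (lt_irrefl _)

variable {n : ℕ}

/-- The first vertices met by a monomial are at most its number of variables, at most its degree.
[folklore] -/
theorem card_image_fst_le_degree (μ : (Fin n × Fin n) × (Fin n × Fin n) →₀ ℕ) :
    (μ.support.image fun e => e.1).card ≤ μ.support.card ∧ μ.support.card ≤ μ.sum fun _ e => e := by
  refine ⟨Finset.card_image_le, ?_⟩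
  rw [Finsupp.sum, Finset.card_eq_sum_ones]
  exact Finset.sum_le_sum fun e he => Nat.one_le_iff_ne_zero.2 (Finsupp.mem_support_iff.1 he)

/-- Every monomial of `D_n · X` (`X ≠ 0`) carries a whole dimer monomial, hence `n²` distinct variables;
so `n² ≤ 2 L₊(D_n · X) + 1` for even `n`. [folklore] -/
theorem sq_le_complexity_triPM_mul (hn : Even n) {X : MvPolynomial ((Fin n × Fin n) × (Fin n × Fin n)) ℝ≥0}
    (hX : X ≠ 0) : n * n ≤ 2 * complexity (triPM n * X) + 1 := by
  classical
  obtain ⟨f₀, hf₀⟩ := dimers_nonempty hn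
  obtain ⟨μ, hμ⟩ := support_nonempty.2 hX
  have hD : dimerExp f₀ ∈ (triPM n).support := (mem_support_triPM _).2 ⟨f₀, hf₀, rfl⟩
  have hmem : dimerExp f₀ + μ ∈ (triPM n * X).support :=
    Literature.Computability.AlgebraicComplexity.add_mem_support_mul hD hμ
  -- the variables `(v, f₀ v)` all occur
  have hsub : (Finset.univ.image fun v : Fin n × Fin n => (v, f₀ v)) ⊆ (triPM n * X).vars := by
    intro e he
    obtain ⟨v, -, rfl⟩ := Finset.mem_image.1 he
    rw [mem_vars_iff_mem_support]
    refine ⟨dimerExp f₀ + μ, hmem, ?_⟩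
    rw [Finsupp.mem_support_iff, Finsupp.add_apply, dimerExp_apply]
    simp
  have hcard : (Finset.univ.image fun v : Fin n × Fin n => (v, f₀ v)).card = n * n := by
    rw [Finset.card_image_of_injective _ (fun v w h => (Prod.ext_iff.1 h).1), Finset.card_univ,
      Fintype.card_prod, Fintype.card_fin]
  calc n * n = (Finset.univ.image fun v : Fin n × Fin n => (v, f₀ v)).card := hcard.symm
    _ ≤ (triPM n * X).vars.card := Finset.card_le_card hsub
    _ ≤ 2 * complexity (triPM n * X) + 1 :=
        Summit.ValiantsHypothesis.Theorems.PerDivisionHardNegative.card_vars_le_complexity _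

end MmBlockFloor

/-- **MM at `D_n` needs cofactors of degree `> n`** (`= √(deg D_n)`; lead c11's disprover-wanted asked for
`≤ n/64`).  No constant `c` admits, for every `n`, a nonzero `X_n` of total degree `≤ n` with
`L₊(D_n · X_n) ≤ 2^((log₂ n + c)^c)`: a monomial of degree `≤ n` meets `≤ n < 2n = (n/2^j)²` first vertices
at `n = 2^(2j+1)`. [cite: Valiant1980, §3 Thm 1] -/
theorem not_mm_certificate_of_degree_le :
    ¬ ∃ c : ℕ, ∀ n : ℕ, ∃ X : MvPolynomial ((Fin n × Fin n) × (Fin n × Fin n)) ℝ≥0,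
      X ≠ 0 ∧ X.totalDegree ≤ n ∧ complexity (triPM n * X) ≤ bound c n := by
  rintro ⟨c, H⟩
  obtain ⟨j, -, hj⟩ := exists_level_blockFloor c
  obtain ⟨X, hX0, hdeg, hle⟩ := H (2 ^ (2 * j + 1))
  obtain ⟨μ, hμ⟩ := support_nonempty.2 hX0
  refine hj X ⟨μ, hμ, ?_⟩ hle
  obtain ⟨h1, h2⟩ := card_image_fst_le_degree μ
  have h3 := le_totalDegree hμ
  have hlt : 2 ^ (2 * j + 1) < 2 ^ (j + 1) * 2 ^ (j + 1) := by
    rw [← pow_add]; exact Nat.pow_lt_pow_right (by norm_num) (by omega)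
  omega

/-- **MM certificates for `D_n` are omnipresent at every quasi-polynomial scale.**  No constant `c`
admits, for every `n`, an `X_n` having a monomial with fewer than `n² / 2^((log₂ n + c)^c)` variables and
`L₊(D_n · X_n) ≤ 2^((log₂ n + c)^c)`: every monomial of a quasi-polynomial MM certificate is as large as
`D_n` itself (which has `n²` variables per monomial) up to a quasi-polynomial factor. [cite: Valiant1980, §3 Thm 1] -/
theorem not_mm_certificate_with_sparse_monomial :
    ¬ ∃ c : ℕ, ∀ n : ℕ, ∃ X : MvPolynomial ((Fin n × Fin n) × (Fin n × Fin n)) ℝ≥0,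
      (∃ μ ∈ X.support, μ.support.card * bound c n < n * n) ∧
      complexity (triPM n * X) ≤ bound c n := by
  rintro ⟨c, H⟩
  obtain ⟨j, hj6, hj⟩ := exists_level_blockFloor c
  obtain ⟨X, ⟨μ, hμ, hsparse⟩, hle⟩ := H (2 ^ (2 * j + 1))
  have hlog : Nat.log 2 (2 ^ (2 * j + 1)) = 2 * j + 1 := Nat.log_pow (by norm_num) _
  rcases Nat.eq_zero_or_pos c with rfl | hc
  · -- `c = 0`: the bound is `2`, but `D_n · X` has `n²` variables
    have hb : bound 0 (2 ^ (2 * j + 1)) = 2 := by unfold bound; simp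
    rw [hb] at hle
    have hX0 : X ≠ 0 := ne_zero_iff.2 ⟨μ, mem_support_iff.1 hμ⟩
    have hn : Even (2 ^ (2 * j + 1)) := Nat.even_pow.2 ⟨even_two, by omega⟩
    have hsq := MmBlockFloor.sq_le_complexity_triPM_mul hn hX0
    have h8 : 8 ≤ 2 ^ (2 * j + 1) := by
      calc 8 = 2 ^ 3 := by norm_num
        _ ≤ 2 ^ (2 * j + 1) := Nat.pow_le_pow_right (by norm_num) (by omega)
    nlinarith
  · -- `c ≥ 1`: the sparse monomial meets fewer than `2n` first vertices
    refine hj X ⟨μ, hμ, ?_⟩ hle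
    have h1 : (μ.support.image fun e => e.1).card ≤ μ.support.card := Finset.card_image_le
    have hbound : 2 ^ (2 * j + 1 + 1) ≤ bound c (2 ^ (2 * j + 1)) := by
      unfold bound; rw [hlog]
      refine Nat.pow_le_pow_right (by norm_num) ?_
      calc 2 * j + 1 + 1 ≤ 2 * j + 1 + c := by omega
        _ ≤ (2 * j + 1 + c) ^ c := Nat.le_self_pow (by omega) _
    have h2 : μ.support.card * 2 ^ (2 * j + 1 + 1) < 2 ^ (2 * j + 1) * 2 ^ (2 * j + 1) :=
      lt_of_le_of_lt (Nat.mul_le_mul_left _ hbound) hsparse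
    have e1 : 2 ^ (2 * j + 1) * 2 ^ (2 * j + 1) = 2 ^ (2 * j) * 2 ^ (2 * j + 1 + 1) := by
      rw [← pow_add, ← pow_add]; congr 1; omega
    rw [e1] at h2
    have h4 : μ.support.card < 2 ^ (2 * j) := Nat.lt_of_mul_lt_mul_right h2
    have h5 : 2 ^ (2 * j) ≤ 2 ^ (j + 1) * 2 ^ (j + 1) := by
      rw [← pow_add]; exact Nat.pow_le_pow_right (by norm_num) (by omega)
    omega

/-! ### The same rungs for the CHARGED crux 4 (`TriangularDimersDivisionEasy`, stmt-ValiantsHypothesis-5067) -/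

/-- **Crux 4 needs denominators of degree `> n`.**  In the Hrubeš–Yehudayoff normal form `D_n · h = g`
of a subtraction-free circuit with division for `D_n`, no family of nonzero denominators `h_n` of total
degree `≤ n` achieves `L₊(D_n · h_n) + L₊(h_n) ≤ 2^((log₂ n + c)^c)` (drop the charge `L₊(h)` and apply
`not_mm_certificate_of_degree_le`). [cite: Valiant1980, §3 Thm 1] -/
theorem not_triDivisionEasy_of_degree_le :
    ¬ ∃ c : ℕ, ∀ n : ℕ, ∃ h : MvPolynomial ((Fin n × Fin n) × (Fin n × Fin n)) ℝ≥0,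
      h ≠ 0 ∧ h.totalDegree ≤ n ∧ complexity (triPM n * h) + complexity h ≤ bound c n := by
  rintro ⟨c, H⟩
  refine not_mm_certificate_of_degree_le ⟨c, fun n => ?_⟩
  obtain ⟨h, h0, hdeg, hle⟩ := H n
  exact ⟨h, h0, hdeg, le_of_add_le_left hle⟩

/-- **Crux 4 needs omnipresent denominators.**  No family of denominators `h_n` having a monomial with
fewer than `n² / 2^((log₂ n + c)^c)` variables achieves `L₊(D_n · h_n) + L₊(h_n) ≤ 2^((log₂ n + c)^c)`
(drop the charge and apply `not_mm_certificate_with_sparse_monomial`): every monomial of a successful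
denominator — like the pivot products of star–mesh elimination or the cleared cells of a condensation
scheme — spreads over the whole rhombus at every quasi-polynomial scale. [cite: Valiant1980, §3 Thm 1] -/
theorem not_triDivisionEasy_with_sparse_monomial :
    ¬ ∃ c : ℕ, ∀ n : ℕ, ∃ h : MvPolynomial ((Fin n × Fin n) × (Fin n × Fin n)) ℝ≥0,
      (∃ μ ∈ h.support, μ.support.card * bound c n < n * n) ∧
      complexity (triPM n * h) + complexity h ≤ bound c n := by
  rintro ⟨c, H⟩
  refine not_mm_certificate_with_sparse_monomial ⟨c, fun n => ?_⟩
  obtain ⟨h, hμ, hle⟩ := H n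
  exact ⟨h, hμ, le_of_add_le_left hle⟩

end Summit.ValiantsHypothesis.ValiantsHypothesis.Theorems.DivisionGapZeroOneTransfer

end
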